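import Literature.AlgebraicGeometry.Motives.UniversalHypersurfaceFibre
import Literature.AlgebraicGeometry.HodgeTheory.MotivatedClassesDeformation
import HarnessLib

/-!
# The universal family of smooth hypersurfaces supported on a set of monomials

Family `hodge`, layer `Literature/AlgebraicGeometry/Motives`. Definition request
`defn-MonomialSupportedHypersurfaceFamily` (route SignSymmetricPowers of the Hodge conjecture, crux
K1-B `stub_signPencilOrbitData`, re-usable by K1-A): ONE named, tree-constructed family over which the
planner can state the family / Picard–Lefschetz / generation / linking pieces of that stub.

## The construction (Voisin, *Hodge Theory II*, §6.2.1, for a linear subsystem; Hartshorne II §3 base change)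

Fix a field `k`, `n d : ℕ` and a set `M ⊆ DegIndex n d` of exponents of degree-`d` monomials in
`x₀, …, x_{n+1}` (e.g. the `ι`-even quinary monomials `{m | Even (m 0 + m 1)}` of an even degree `d`,
`ι = diag(−1,−1,1,1,1)`). Write `R = CoeffRing k n d = k[a_m | |m| = d]` and `R_M = k[a_m | m ∈ M]`
(`CoeffRingM`).

* `killHom M : R →ₐ[k] R_M`, `a_m ↦ a_m` (`m ∈ M`), `a_m ↦ 0` (`m ∉ M`): the closed immersion
  `𝔸^M ↪ S^d = 𝔸^{DegIndex n d}` of the linear subspace of `M`-supported forms (`specKill`).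
* `baseMOpens M = specKill⁻¹(U) ⊆ Spec R_M` — the Zariski open set of NONSINGULAR `M`-supported forms
  (`U = baseOpens k n d` the nonsingular forms, file `Motives/UniversalHypersurfaceFamily`); `baseM M`
  the same as a `k`-scheme, `toBase M : baseM M ⟶ base k n d` the restriction of `specKill`.
* `familyM M : totalM M ⟶ baseM M` — **the universal family of smooth hypersurfaces of degree `d` in
  `ℙⁿ⁺¹` supported on `M`**: the base change (`Motives.familyPullback`) of the universal family
  `family k n d : 𝒴_U ⟶ U` along `toBase M`.
* `IsSupportedOn M G` — the form `G` has `coeff_m G = 0` for every degree-`d` exponent `m ∉ M`;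
  `coeffHomM M G : R_M →ₐ[k] k`, `a_m ↦ coeff_m G`; `pointOfFormM` — the `k`-point `[G] ∈ baseM M (k)` of
  a nonsingular `M`-supported form `G` of degree `d`.

## What is proved

* `isSmoothProjectiveFamily_familyM`: for `n ≥ 1`, `d ≥ 1`, `familyM M` is a smooth projective family
  of relative dimension `n` (`IsSmoothProjectiveFamily.familyPullback_snd` +
  `isSmoothProjectiveFamily_family`).
* `map_toBase_pointOfFormM`: `toBase M` sends `[G] ∈ baseM M(k)` to `pointOfForm G ∈ U(k)`;
  `fiberOverFamilyMIso`: **the fibre of `familyM M` over `[G]` is the hypersurface `X_G`**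
  (`fiberOverFamilyPullbackIso` + `nonempty_fiberOver_iso_hypersurface`), so it is a smooth projective
  `n`-fold (`isSmoothProjective_fiberOver_familyM_pointOfFormM`).
* Points: every `k`-point `t` of `baseM M` is `[G]` for the nonsingular `M`-supported form
  `G = pointFormM t` (`pointOfFormM_pointFormM`, `isSupportedOn_pointFormM`), and `[·]` is injective on
  such forms (`pointFormM_pointOfFormM`).
* The base: `toBase M` and `baseM M ⟶ 𝔸^M` are (closed, resp. open) immersions; `baseM M → Spec k` is
  smooth (`smooth_baseM_hom`, open subscheme of affine space), `baseM M` is quasi-projective over `k`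
  (`isQuasiProjectiveOver_baseM`) and irreducible as soon as it has a point
  (`irreducibleSpace_baseM_left`, non-empty open of the irreducible `𝔸^M`); it has a point iff some
  `M`-supported form of degree `d` is nonsingular (`nonempty_algPoints_baseM_iff`).

Companion file `HodgeTheory/MonomialSupportedHypersurfaceFamilyPoints`: over `ℂ`, cohomological local
triviality of `familyM M` on all of `baseM M(ℂ)` (Ehresmann) and the polynomial-avoidance clause (ALG)
in coefficient coordinates.

## Design notes

* `M` is a `Set (DegIndex n d)` (finite automatically), used as the index TYPE `↥M` of `R_M`; the
  support condition only constrains degree-`d` exponents (a homogeneous `G` of degree `d` has no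
  others, `IsHomogeneous.coeff_eq_zero`).
* The base change is taken along the (non-flat) closed immersion `𝔸^M ∩ U ↪ U`; smoothness,
  properness and the fibres are stable under arbitrary base change, which is all that is used. The
  total space `totalM M` is NOT identified with `V₊(Σ_{m ∈ M} a_m x^m) ⊆ ℙⁿ⁺¹_{R_M}` here (not needed by
  the consumers: fibres are identified pointwise).
* NOT here: the relative diagonal automorphism of `totalM M` for a diagonal `γ` fixing the monomials
  of `M` and its action on monodromy (separate file), the discriminant of `M`-supported forms as a
  polynomial, irreducible components of the discriminant.

## References

* C. Voisin, *Hodge Theory and Complex Algebraic Geometry II* (2003), §6.2.1 (the universal smooth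
  hypersurface `π : 𝒴 → B`, `B ⊂ H⁰(X, 𝒪_X(Y))` the nonsingular members). [VoisinHodgeII2003]
* R. Hartshorne, *Algebraic Geometry* (1977), II §3 (base extension, fibres), III §10. [Hartshorne1977]
-/

noncomputable section

open CategoryTheory AlgebraicGeometry MvPolynomial Limits

universe u

namespace Literature.AlgebraicGeometry.Motives.UniversalHypersurface

/-! ### `M`-supported forms and the linear subspace `𝔸^M ⊆ S^d` -/

section Defs

variable (k : Type u) [Field k] (n d : ℕ) (M : Set (DegIndex n d))

/-- A form `G ∈ K[x₀, …, x_{n+1}]` is **supported on the monomials of `M`** if its coefficient at every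
degree-`d` exponent outside `M` vanishes (for `G` homogeneous of degree `d`: `G = Σ_{m ∈ M} c_m x^m`).
[cite: VoisinHodgeII2003, §6.2.1] -/
def IsSupportedOn {K : Type*} [CommSemiring K] (G : MvPolynomial (Fin (n + 2)) K) : Prop :=
  ∀ m : DegIndex n d, m ∉ M → coeff m.1 G = 0

/-- The coefficient ring `R_M = k[a_m | m ∈ M]` of the affine space `𝔸^M` of `M`-supported forms of
degree `d` (the linear subsystem of `S^d = H⁰(ℙⁿ⁺¹, 𝒪(d))` spanned by the monomials of `M`;
Voisin II, §6.2.1). [cite: VoisinHodgeII2003, §6.2.1] -/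
abbrev CoeffRingM : Type u := MvPolynomial M k

/-- The surjection `R = k[a_m | |m| = d] → R_M = k[a_m | m ∈ M]` killing the coefficients `a_m`,
`m ∉ M`: the comorphism of the closed immersion `𝔸^M ↪ S^d` of `M`-supported forms.
[cite: Hartshorne1977, II Ex. 2.18(c)] -/
def killHom : CoeffRing k n d →ₐ[k] CoeffRingM k n d M :=
  aeval fun m : DegIndex n d => by
    classical
    exact if h : m ∈ M then X ⟨m, h⟩ else 0

/-- `killHom` on a coefficient variable of `M` is that variable. [cite: Hartshorne1977, II Ex. 2.18(c)] -/
@[simp]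
theorem killHom_X_of_mem {m : DegIndex n d} (h : m ∈ M) :
    killHom k n d M (X m) = X ⟨m, h⟩ := by
  classical
  rw [killHom, aeval_X, dif_pos h]

/-- `killHom` kills the coefficient variables outside `M`. [cite: Hartshorne1977, II Ex. 2.18(c)] -/
@[simp]
theorem killHom_X_of_not_mem {m : DegIndex n d} (h : m ∉ M) :
    killHom k n d M (X m) = 0 := by
  classical
  rw [killHom, aeval_X, dif_neg h]

/-- `killHom` is surjective (`a_m ↦ a_m` hits every generator of `R_M`). [cite: Hartshorne1977, II Ex. 2.18(c)] -/
theorem killHom_surjective : Function.Surjective (killHom k n d M) := by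
  intro p
  refine ⟨rename (fun m : M => (m : DegIndex n d)) p, ?_⟩
  induction p using MvPolynomial.induction_on with
  | C a => simp [killHom]
  | add p q hp hq => rw [map_add, map_add, hp, hq]
  | mul_X p m hp => rw [map_mul, map_mul, hp, rename_X, killHom_X_of_mem k n d M m.2]

/-- **The closed immersion `𝔸^M ↪ S^d`** of the affine space of `M`-supported forms into the affine
space of all forms of degree `d` (`Spec` of `killHom`). [cite: Hartshorne1977, II Ex. 2.18(c)–(d)] -/
abbrev specKill : Spec (.of (CoeffRingM k n d M)) ⟶ Spec (.of (CoeffRing k n d)) :=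
  Spec.map (CommRingCat.ofHom (killHom k n d M).toRingHom)

/-- `𝔸^M ↪ S^d` is a closed immersion (`killHom` is surjective). [cite: Hartshorne1977, II Ex. 2.18(c)–(d)] -/
theorem isClosedImmersion_specKill : IsClosedImmersion (specKill k n d M) :=
  IsClosedImmersion.spec_of_surjective _ (killHom_surjective k n d M)

/-- The structure morphism `𝔸^M = Spec R_M → Spec k`. [cite: Hartshorne1977, II §3 (schemes over `S`), p. 89] -/
abbrev specMToSpec : Spec (.of (CoeffRingM k n d M)) ⟶ Spec (.of k) :=
  Spec.map (CommRingCat.ofHom (algebraMap k (CoeffRingM k n d M)))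

/-- `𝔸^M ↪ S^d → Spec k` is `𝔸^M → Spec k` (`killHom` is a `k`-algebra map). [cite: Hartshorne1977, II §3
(fibres and base extension), p. 89] -/
@[reassoc]
theorem specKill_comp_specCoeffToSpec :
    specKill k n d M ≫ specCoeffToSpec k n d = specMToSpec k n d M := by
  rw [← Spec.map_comp, ← CommRingCat.ofHom_comp]
  congr 2
  exact RingHom.ext fun r => (killHom k n d M).commutes r

/-! ### The base `baseM M`: nonsingular `M`-supported forms -/

/-- **The Zariski open set of nonsingular `M`-supported forms of degree `d`**, as an open subset of
`𝔸^M = Spec R_M`: the preimage of the open set `U ⊆ S^d` of nonsingular forms (`baseOpens`, Voisin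
II §6.2.1) under `𝔸^M ↪ S^d`. [cite: VoisinHodgeII2003, §6.2.1] -/
abbrev baseMOpens : (Spec (CommRingCat.of (CoeffRingM k n d M))).Opens :=
  specKill k n d M ⁻¹ᵁ baseOpens k n d

/-- Membership in `baseMOpens`: the image in `S^d` is a nonsingular form (`Iff.rfl`). [cite:
VoisinHodgeII2003, §6.2.1] -/
theorem mem_baseMOpens_iff (x : Spec (CommRingCat.of (CoeffRingM k n d M))) :
    x ∈ baseMOpens k n d M ↔ specKill k n d M x ∈ baseOpens k n d :=
  Iff.rfl

/-- **The base `S_M` of the `M`-supported family as a `k`-scheme**: the open subscheme of nonsingular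
`M`-supported forms of `𝔸^M`, with structure map `S_M ⊆ 𝔸^M → Spec k`. [cite: VoisinHodgeII2003, §6.2.1] -/
def baseM : SchemeOver k := Over.mk ((baseMOpens k n d M).ι ≫ specMToSpec k n d M)

/-- The underlying scheme of `baseM M` is the open subscheme `baseMOpens M` (`rfl`). [cite:
VoisinHodgeII2003, §6.2.1] -/
theorem baseM_left : (baseM k n d M).left = (baseMOpens k n d M).toScheme := rfl

/-- The structure map of `baseM M` is `S_M ⊆ 𝔸^M → Spec k` (`rfl`). [cite: VoisinHodgeII2003, §6.2.1] -/
theorem baseM_hom : (baseM k n d M).hom = (baseMOpens k n d M).ι ≫ specMToSpec k n d M := rfl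

/-- **The morphism of bases `S_M ⟶ U`**: the restriction of `𝔸^M ↪ S^d` over the open set `U` of
nonsingular forms (Mathlib `morphismRestrict`), as a morphism of `k`-schemes.
[cite: Hartshorne1977, II §3 (fibres and base extension), p. 89] -/
def toBase : baseM k n d M ⟶ base k n d :=
  Over.homMk (specKill k n d M ∣_ baseOpens k n d) (by
    change (specKill k n d M ∣_ baseOpens k n d) ≫ (baseOpens k n d).ι ≫ specCoeffToSpec k n d =
      (baseMOpens k n d M).ι ≫ specMToSpec k n d M
    rw [morphismRestrict_ι_assoc, specKill_comp_specCoeffToSpec])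

/-- The underlying morphism of `toBase M` is the restricted immersion (`rfl`). [cite: Hartshorne1977, II §3
(fibres and base extension), p. 89] -/
theorem toBase_left : (toBase k n d M).left = specKill k n d M ∣_ baseOpens k n d := rfl

/-- `S_M ⟶ U ⊆ S^d` is `S_M ⊆ 𝔸^M ↪ S^d`. [cite: Hartshorne1977, II §3 (fibres and base extension), p. 89] -/
@[reassoc]
theorem toBase_left_comp_ι :
    (toBase k n d M).left ≫ (baseOpens k n d).ι = (baseMOpens k n d M).ι ≫ specKill k n d M :=
  morphismRestrict_ι _ _

/-- `S_M ⟶ U` is a closed immersion (base change of the closed immersion `𝔸^M ↪ S^d` to the open `U`).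
[cite: Hartshorne1977, II Ex. 3.11(a)] -/
theorem isClosedImmersion_toBase_left : IsClosedImmersion (toBase k n d M).left := by
  rw [toBase_left]
  exact IsZariskiLocalAtTarget.restrict (P := @IsClosedImmersion)
    (isClosedImmersion_specKill k n d M) _

/-! ### The family `familyM M : totalM M ⟶ baseM M` -/

/-- **The total space `𝒴_M = 𝒴_U ×_U S_M`** of the `M`-supported family: the base change of the
universal smooth hypersurface along `S_M ⟶ U` (`Motives.familyPullback`; Hartshorne II §3).
[cite: Hartshorne1977, II §3 (base extension)] -/
def totalM : SchemeOver k := familyPullback (family k n d) (toBase k n d M)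

/-- **The universal family of smooth hypersurfaces of degree `d` in `ℙⁿ⁺¹_k` supported on `M`**,
`π_M : 𝒴_M ⟶ S_M`: the base change of the universal family `π : 𝒴_U → U` (Voisin II, §6.2.1) along
`S_M ⟶ U` (`Motives.familyPullback.snd`). [cite: VoisinHodgeII2003, §6.2.1] -/
def familyM : totalM k n d M ⟶ baseM k n d M := familyPullback.snd (family k n d) (toBase k n d M)

/-- The projection `𝒴_M ⟶ 𝒴_U` of the base change (`Motives.familyPullback.fst`). [cite: Hartshorne1977, II
§3 (fibres and base extension), p. 89] -/
def totalMToTotal : totalM k n d M ⟶ total k n d := familyPullback.fst (family k n d) (toBase k n d M)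

/-- `familyM M` is literally `familyPullback.snd (family k n d) (toBase M)` (`rfl`; use to rewrite into
the general base-change API, e.g. `fiberOverFamilyPullbackIso`). [cite: Hartshorne1977, II §3 (fibres and
base extension), p. 89] -/
theorem familyM_eq : familyM k n d M = familyPullback.snd (family k n d) (toBase k n d M) := rfl

/-- The base-change square `𝒴_M ⟶ 𝒴_U ⟶ U = 𝒴_M ⟶ S_M ⟶ U` commutes. [cite: Hartshorne1977, II §3 (fibres
and base extension), p. 89] -/
@[reassoc]
theorem totalMToTotal_comp_family :
    totalMToTotal k n d M ≫ family k n d = familyM k n d M ≫ toBase k n d M :=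
  familyPullback.condition _ _

/-- The base-change square is cartesian in `k`-schemes. [cite: Hartshorne1977, II Thm. 3.3 and §3 (base
extension), p. 89] -/
theorem isPullback_totalM :
    IsPullback (totalMToTotal k n d M) (familyM k n d M) (family k n d) (toBase k n d M) :=
  familyPullback.isPullback _ _

/-- **`π_M : 𝒴_M ⟶ S_M` is a smooth projective family of relative dimension `n`** for `n ≥ 1`, `d ≥ 1`:
base change (`IsSmoothProjectiveFamily.familyPullback_snd`) of the smooth projective universal family
(`isSmoothProjectiveFamily_family`). [cite: VoisinHodgeII2003, §6.2.1] -/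
theorem isSmoothProjectiveFamily_familyM (hn : 1 ≤ n) (hd : 1 ≤ d) :
    IsSmoothProjectiveFamily (familyM k n d M) n :=
  (isSmoothProjectiveFamily_family k hn hd).familyPullback_snd _

end Defs

/-! ### The point `[G] ∈ S_M(k)` of a nonsingular `M`-supported form -/

section OfForm

variable (k : Type u) [Field k] (n d : ℕ) (M : Set (DegIndex n d))

/-- The coefficient homomorphism `R_M → k`, `a_m ↦ coeff_m G` (`m ∈ M`), of a form `G`: the `k`-point
`[G]` of `𝔸^M`. [cite: VoisinHodgeII2003, §6.2.1] -/
abbrev coeffHomM (G : MvPolynomial (Fin (n + 2)) k) : CoeffRingM k n d M →ₐ[k] k :=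
  aeval fun m : M => coeff m.1.1 G

/-- For an `M`-supported form, `[G] ∈ 𝔸^M` maps to `[G] ∈ S^d`: `coeffHomM G ∘ killHom = coeffHom G`.
[cite: VoisinHodgeII2003, §6.2.1] -/
theorem coeffHomM_comp_killHom {G : MvPolynomial (Fin (n + 2)) k} (hM : IsSupportedOn n d M G) :
    (coeffHomM k n d M G).comp (killHom k n d M) = coeffHom k n d G := by
  refine MvPolynomial.algHom_ext fun m => ?_
  by_cases h : m ∈ M
  · rw [AlgHom.comp_apply, killHom_X_of_mem k n d M h, aeval_X, aeval_X]
  · rw [AlgHom.comp_apply, killHom_X_of_not_mem k n d M h, map_zero, aeval_X]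
    exact (hM m h).symm

/-- The same on ring homomorphisms / `Spec`: `Spec k →[G] 𝔸^M ↪ S^d` is `Spec k →[G] S^d`. [cite:
VoisinHodgeII2003, §6.2.1] -/
@[reassoc]
theorem specMap_coeffHomM_comp_specKill {G : MvPolynomial (Fin (n + 2)) k}
    (hM : IsSupportedOn n d M G) :
    Spec.map (CommRingCat.ofHom (coeffHomM k n d M G).toRingHom) ≫ specKill k n d M =
      Spec.map (CommRingCat.ofHom (coeffHom k n d G).toRingHom) := by
  rw [← Spec.map_comp, ← CommRingCat.ofHom_comp]
  congr 2
  exact congrArg AlgHom.toRingHom (coeffHomM_comp_killHom k n d M hM)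

/-- **The point `[G] ∈ 𝔸^M(k)` of a nonsingular `M`-supported form lies in `S_M`**: its image in `S^d`
is the point `[G]`, which lies in `U` (`specMap_coeffHom_apply_mem_baseOpens`, Hartshorne I Ex. 5.8).
[cite: Hartshorne1977, I Ex. 5.8] -/
theorem specMap_coeffHomM_apply_mem_baseMOpens {G : MvPolynomial (Fin (n + 2)) k}
    (hG : G.IsHomogeneous d) (hJ : SmoothHypersurface.IsNonsingularForm k G)
    (hM : IsSupportedOn n d M G) (y : Spec (.of k)) :
    Spec.map (CommRingCat.ofHom (coeffHomM k n d M G).toRingHom) y ∈ baseMOpens k n d M := by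
  rw [mem_baseMOpens_iff, ← Scheme.Hom.comp_apply, specMap_coeffHomM_comp_specKill k n d M hM]
  exact specMap_coeffHom_apply_mem_baseOpens k n d hG hJ y

/-- The morphism `Spec k → S_M` of a nonsingular `M`-supported form `G`: `[G] ∈ 𝔸^M` lifted through
the open immersion `S_M ⊆ 𝔸^M` (Mathlib `IsOpenImmersion.lift`). [cite: VoisinHodgeII2003, §6.2.1] -/
def pointOfFormMHom {G : MvPolynomial (Fin (n + 2)) k} (hG : G.IsHomogeneous d)
    (hJ : SmoothHypersurface.IsNonsingularForm k G) (hM : IsSupportedOn n d M G) :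
    Spec (.of k) ⟶ (baseMOpens k n d M).toScheme :=
  IsOpenImmersion.lift (baseMOpens k n d M).ι
    (Spec.map (CommRingCat.ofHom (coeffHomM k n d M G).toRingHom))
    (by
      rintro _ ⟨y, rfl⟩
      rw [Scheme.Opens.range_ι]
      exact specMap_coeffHomM_apply_mem_baseMOpens k n d M hG hJ hM y)

/-- `pointOfFormMHom` followed by `S_M ⊆ 𝔸^M` is the point `[G]` of `𝔸^M`. [cite: VoisinHodgeII2003, §6.2.1] -/
@[reassoc]
theorem pointOfFormMHom_ι {G : MvPolynomial (Fin (n + 2)) k} (hG : G.IsHomogeneous d)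
    (hJ : SmoothHypersurface.IsNonsingularForm k G) (hM : IsSupportedOn n d M G) :
    pointOfFormMHom k n d M hG hJ hM ≫ (baseMOpens k n d M).ι =
      Spec.map (CommRingCat.ofHom (coeffHomM k n d M G).toRingHom) :=
  IsOpenImmersion.lift_fac _ _ _

/-- **The point `[G] ∈ S_M(k)` of a nonsingular `M`-supported form `G` of degree `d`**, as a
`k`-point of the base of the `M`-supported family. [cite: VoisinHodgeII2003, §6.2.1] -/
def pointOfFormM {G : MvPolynomial (Fin (n + 2)) k} (hG : G.IsHomogeneous d)
    (hJ : SmoothHypersurface.IsNonsingularForm k G) (hM : IsSupportedOn n d M G) :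
    AlgPoints (baseM k n d M) k :=
  AlgPoints.mk (X := baseM k n d M) (pointOfFormMHom k n d M hG hJ hM)
    (by
      have hc : (coeffHomM k n d M G).toRingHom.comp (algebraMap k (CoeffRingM k n d M)) =
          algebraMap k k :=
        RingHom.ext fun r => (coeffHomM k n d M G).commutes r
      change (pointOfFormMHom k n d M hG hJ hM ≫ (baseMOpens k n d M).ι) ≫ specMToSpec k n d M = _
      rw [pointOfFormMHom_ι, ← Spec.map_comp, ← CommRingCat.ofHom_comp, hc])

/-- The underlying morphism of `[G] ∈ S_M(k)` is `pointOfFormMHom` (`rfl`). [cite: VoisinHodgeII2003, §6.2.1] -/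
theorem pointOfFormM_left {G : MvPolynomial (Fin (n + 2)) k} (hG : G.IsHomogeneous d)
    (hJ : SmoothHypersurface.IsNonsingularForm k G) (hM : IsSupportedOn n d M G) :
    (pointOfFormM k n d M hG hJ hM).left = pointOfFormMHom k n d M hG hJ hM := rfl

/-- `[G] ∈ S_M(k)` followed by `S_M ⊆ 𝔸^M` is the point `[G]` of `𝔸^M` (on underlying morphisms of
schemes). [cite: VoisinHodgeII2003, §6.2.1] -/
@[reassoc]
theorem pointOfFormM_left_comp_ι {G : MvPolynomial (Fin (n + 2)) k} (hG : G.IsHomogeneous d)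
    (hJ : SmoothHypersurface.IsNonsingularForm k G) (hM : IsSupportedOn n d M G) :
    (pointOfFormM k n d M hG hJ hM).left ≫ (baseMOpens k n d M).ι =
      Spec.map (CommRingCat.ofHom (coeffHomM k n d M G).toRingHom) :=
  pointOfFormMHom_ι k n d M hG hJ hM

/-- **`S_M ⟶ U` sends `[G] ∈ S_M(k)` to `[G] ∈ U(k)`** (`pointOfForm`, file
`Motives/UniversalHypersurfaceFibre`): both are `Spec k → U` followed by `U ⊆ S^d` equal to the point
`[G]` of `S^d`, and `U ⊆ S^d` is a monomorphism. [cite: VoisinHodgeII2003, §6.2.1] -/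
theorem map_toBase_pointOfFormM {G : MvPolynomial (Fin (n + 2)) k} (hG : G.IsHomogeneous d)
    (hJ : SmoothHypersurface.IsNonsingularForm k G) (hM : IsSupportedOn n d M G) :
    AlgPoints.map (toBase k n d M) (pointOfFormM k n d M hG hJ hM) = pointOfForm k n d hG hJ := by
  have e1 : (AlgPoints.map (toBase k n d M) (pointOfFormM k n d M hG hJ hM)).left ≫ (baseOpens k n d).ι =
      Spec.map (CommRingCat.ofHom (coeffHom k n d G).toRingHom) := by
    show (pointOfFormMHom k n d M hG hJ hM ≫ (specKill k n d M ∣_ baseOpens k n d)) ≫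
      (baseOpens k n d).ι = _
    rw [Category.assoc, morphismRestrict_ι, pointOfFormMHom_ι_assoc,
      specMap_coeffHomM_comp_specKill k n d M hM]
  have e2 : (pointOfForm k n d hG hJ).left ≫ (baseOpens k n d).ι =
      Spec.map (CommRingCat.ofHom (coeffHom k n d G).toRingHom) :=
    pointOfFormHom_ι k n d hG hJ
  exact Over.OverMorphism.ext ((cancel_mono (baseOpens k n d).ι).mp (e1.trans e2.symm))

/-- **The fibre of the `M`-supported family over `[G]` is the hypersurface `X_G`** (`d ≥ 1`): the fibre
of a base change is the fibre of the original family over the image point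
(`fiberOverFamilyPullbackIso`), that point is `[G] ∈ U(k)` (`map_toBase_pointOfFormM`), and the fibre
of the universal family over `[G]` is `X_G` (`nonempty_fiberOver_iso_hypersurface`,
`pointForm_pointOfForm`; Voisin II §6.2.1 "the fibre over `f ∈ B` is `Y_f`"). A chosen isomorphism of
`k`-schemes. [cite: VoisinHodgeII2003, §6.2.1] -/
def fiberOverFamilyMIso (hd : 0 < d) {G : MvPolynomial (Fin (n + 2)) k} (hG : G.IsHomogeneous d)
    (hJ : SmoothHypersurface.IsNonsingularForm k G) (hM : IsSupportedOn n d M G) :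
    fiberOver (familyM k n d M) (pointOfFormM k n d M hG hJ hM) ≅ SmoothHypersurface.hypersurface G :=
  fiberOverFamilyPullbackIso (family k n d) (toBase k n d M) (pointOfFormM k n d M hG hJ hM) ≪≫
    eqToIso (congrArg (fiberOver (family k n d)) (map_toBase_pointOfFormM k n d M hG hJ hM)) ≪≫
      (nonempty_fiberOver_iso_hypersurface k n d (pointOfForm k n d hG hJ) hd).some ≪≫
        eqToIso (congrArg SmoothHypersurface.hypersurface (pointForm_pointOfForm k n d hG hJ))

/-- Hence the fibre of the `M`-supported family over `[G]` is isomorphic to `X_G` (the `Nonempty`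
form of `fiberOverFamilyMIso`). [cite: VoisinHodgeII2003, §6.2.1] -/
theorem nonempty_fiberOver_familyM_iso_hypersurface (hd : 0 < d) {G : MvPolynomial (Fin (n + 2)) k}
    (hG : G.IsHomogeneous d) (hJ : SmoothHypersurface.IsNonsingularForm k G)
    (hM : IsSupportedOn n d M G) :
    Nonempty (fiberOver (familyM k n d M) (pointOfFormM k n d M hG hJ hM) ≅
      SmoothHypersurface.hypersurface G) :=
  ⟨fiberOverFamilyMIso k n d M hd hG hJ hM⟩

end OfForm

/-! ### The points of `S_M` and their forms -/

section Points

variable (k : Type u) [Field k] (n d : ℕ) (M : Set (DegIndex n d)) {K : Type u} [Field K] [Algebra k K]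

/-- `S_M ⟶ U` is injective on `K`-points (a closed immersion is a monomorphism). [cite: Hartshorne1977, II
Ex. 3.11(a)] -/
theorem map_toBase_injective : Function.Injective (AlgPoints.map (toBase k n d M) (L := K)) := by
  intro s t h
  haveI := isClosedImmersion_toBase_left k n d M
  have h1 : s.left ≫ (toBase k n d M).left = t.left ≫ (toBase k n d M).left := by
    rw [← Over.comp_left, ← Over.comp_left]
    exact congrArg Over.Hom.left h
  exact Over.OverMorphism.ext ((cancel_mono (toBase k n d M).left).mp h1)

/-- The **coefficient homomorphism** `R_M → K` of a `K`-point `t` of `S_M` (`Spec K → S_M ⊆ 𝔸^M`,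
Mathlib `Spec.preimage`). [cite: VoisinHodgeII2003, §6.2.1] -/
def pointHomM (t : AlgPoints (baseM k n d M) K) :
    CommRingCat.of (CoeffRingM k n d M) ⟶ CommRingCat.of K :=
  Spec.preimage (t.left ≫ (baseMOpens k n d M).ι)

/-- `Spec (pointHomM t)` is the point `t` followed by `S_M ⊆ 𝔸^M`. [cite: VoisinHodgeII2003, §6.2.1] -/
theorem Spec_map_pointHomM (t : AlgPoints (baseM k n d M) K) :
    Spec.map (pointHomM k n d M t) = t.left ≫ (baseMOpens k n d M).ι :=
  Spec.map_preimage _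

/-- The coefficient homomorphism of a point of `S_M` is a `k`-algebra map. [cite: VoisinHodgeII2003, §6.2.1] -/
theorem pointHomM_comp_algebraMap (t : AlgPoints (baseM k n d M) K) :
    (pointHomM k n d M t).hom.comp (algebraMap k (CoeffRingM k n d M)) = algebraMap k K := by
  have hw : Spec.map (pointHomM k n d M t) ≫ specMToSpec k n d M =
      Spec.map (CommRingCat.ofHom (algebraMap k K)) := by
    rw [reassoc_of% (Spec_map_pointHomM k n d M t)]
    exact Over.w t
  rw [← Spec.map_comp] at hw
  have := congrArg CommRingCat.Hom.hom (Spec.map_injective hw)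
  simpa using this

/-- **The coefficient homomorphism of the image point in `U` factors through `killHom`**:
`pointHom (toBase t) = pointHomM t ∘ killHom` — the form of `t` read in `S^d` has the coefficients
`t(a_m)` for `m ∈ M` and `0` for `m ∉ M`. [cite: VoisinHodgeII2003, §6.2.1] -/
theorem pointHom_map_toBase (t : AlgPoints (baseM k n d M) K) :
    pointHom k n d (AlgPoints.map (toBase k n d M) t) =
      CommRingCat.ofHom (killHom k n d M).toRingHom ≫ pointHomM k n d M t := by
  apply Spec.map_injective
  rw [Spec.map_comp, Spec_map_pointHomM, Spec_map_pointHom]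
  calc (AlgPoints.map (toBase k n d M) t).left ≫ (baseOpens k n d).ι
      = (t.left ≫ (toBase k n d M).left) ≫ (baseOpens k n d).ι := rfl
    _ = t.left ≫ ((toBase k n d M).left ≫ (baseOpens k n d).ι) := Category.assoc _ _ _
    _ = t.left ≫ ((baseMOpens k n d M).ι ≫ specKill k n d M) :=
        whisker_eq _ (toBase_left_comp_ι k n d M)
    _ = (t.left ≫ (baseMOpens k n d M).ι) ≫ specKill k n d M := (Category.assoc _ _ _).symm

/-- **The form `F_t ∈ K[x₀, …, x_{n+1}]` of a `K`-point `t` of `S_M`**: the form of its image in `U`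
(`pointForm`), i.e. `Σ_{m ∈ M} t(a_m) x^m`. An `abbrev`, so that `isHomogeneous_pointForm`,
`isNonsingularForm_pointForm`, `coeff_pointForm` apply verbatim. [cite: VoisinHodgeII2003, §6.2.1] -/
abbrev pointFormM (t : AlgPoints (baseM k n d M) K) : MvPolynomial (Fin (n + 2)) K :=
  pointForm k n d (AlgPoints.map (toBase k n d M) t)

/-- The coefficients of the form of a point of `S_M`: `t(a_m)` for `m ∈ M`. [cite: VoisinHodgeII2003, §6.2.1] -/
theorem coeff_pointFormM_of_mem (t : AlgPoints (baseM k n d M) K) {m : DegIndex n d} (hm : m ∈ M) :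
    coeff m.1 (pointFormM k n d M t) = (pointHomM k n d M t).hom (X ⟨m, hm⟩) := by
  rw [coeff_pointForm, pointHom_map_toBase, CommRingCat.hom_comp, CommRingCat.hom_ofHom,
    RingHom.comp_apply, AlgHom.toRingHom_eq_coe, AlgHom.coe_toRingHom, killHom_X_of_mem k n d M hm]

/-- **The form of a point of `S_M` is supported on `M`**: its coefficient at `m ∉ M` is
`t(killHom a_m) = t(0) = 0`. [cite: VoisinHodgeII2003, §6.2.1] -/
theorem isSupportedOn_pointFormM (t : AlgPoints (baseM k n d M) K) :
    IsSupportedOn n d M (pointFormM k n d M t) := by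
  intro m hm
  rw [coeff_pointForm, pointHom_map_toBase, CommRingCat.hom_comp, CommRingCat.hom_ofHom,
    RingHom.comp_apply, AlgHom.toRingHom_eq_coe, AlgHom.coe_toRingHom,
    killHom_X_of_not_mem k n d M hm, map_zero]

/-- The coefficient homomorphism of the point `[F_t]` built from the form of `t` is that of `t`.
[cite: VoisinHodgeII2003, §6.2.1] -/
theorem coeffHomM_pointFormM (t : AlgPoints (baseM k n d M) k) :
    CommRingCat.ofHom (coeffHomM k n d M (pointFormM k n d M t)).toRingHom = pointHomM k n d M t := by
  ext1
  rw [CommRingCat.hom_ofHom]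
  refine MvPolynomial.ringHom_ext (fun r => ?_) fun m => ?_
  · have ht := congrArg (fun φ : k →+* k => φ r) (pointHomM_comp_algebraMap k n d M t)
    simp only [RingHom.comp_apply] at ht
    rw [MvPolynomial.algebraMap_eq] at ht
    rw [ht, AlgHom.toRingHom_eq_coe, AlgHom.coe_toRingHom, ← MvPolynomial.algebraMap_eq,
      AlgHom.commutes]
  · rw [AlgHom.toRingHom_eq_coe, AlgHom.coe_toRingHom, aeval_X]
    exact coeff_pointFormM_of_mem k n d M t m.2

/-- **Every `k`-point of `S_M` is the point `[F_t]` of its form** (`S_M ⊆ 𝔸^M` is a monomorphism and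
both have coefficient homomorphism `pointHomM t`). [cite: VoisinHodgeII2003, §6.2.1] -/
theorem pointOfFormM_pointFormM (t : AlgPoints (baseM k n d M) k) :
    pointOfFormM k n d M (isHomogeneous_pointForm k n d _) (isNonsingularForm_pointForm k n d _)
      (isSupportedOn_pointFormM k n d M t) = t := by
  have e1 := pointOfFormM_left_comp_ι k n d M (isHomogeneous_pointForm k n d _)
    (isNonsingularForm_pointForm k n d _) (isSupportedOn_pointFormM k n d M t)
  rw [coeffHomM_pointFormM, Spec_map_pointHomM] at e1
  exact Over.OverMorphism.ext ((cancel_mono (baseMOpens k n d M).ι).mp e1)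

/-- **The form of the point `[G]` is `G`** (for `G` nonsingular, homogeneous of degree `d`, supported on
`M`). [cite: VoisinHodgeII2003, §6.2.1] -/
theorem pointFormM_pointOfFormM {G : MvPolynomial (Fin (n + 2)) k} (hG : G.IsHomogeneous d)
    (hJ : SmoothHypersurface.IsNonsingularForm k G) (hM : IsSupportedOn n d M G) :
    pointFormM k n d M (pointOfFormM k n d M hG hJ hM) = G := by
  rw [pointFormM, map_toBase_pointOfFormM, pointForm_pointOfForm]

/-- Hence **the `k`-points of `S_M` are exactly the nonsingular `M`-supported forms of degree `d`**:
`S_M(k)` is non-empty iff such a form exists. [cite: VoisinHodgeII2003, §6.2.1] -/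
theorem nonempty_algPoints_baseM_iff :
    Nonempty (AlgPoints (baseM k n d M) k) ↔ ∃ G : MvPolynomial (Fin (n + 2)) k,
      G.IsHomogeneous d ∧ SmoothHypersurface.IsNonsingularForm k G ∧ IsSupportedOn n d M G :=
  ⟨fun ⟨t⟩ => ⟨pointFormM k n d M t, isHomogeneous_pointForm k n d _,
      isNonsingularForm_pointForm k n d _, isSupportedOn_pointFormM k n d M t⟩,
    fun ⟨_, hG, hJ, hM⟩ => ⟨pointOfFormM k n d M hG hJ hM⟩⟩

/-- **The classifying map with a fallback point**: a form `G` goes to its point `[G] ∈ S_M(k)` when it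
is homogeneous of degree `d`, nonsingular and supported on `M`, and to the given point `t₀` otherwise
(a documented junk value, so that route statements can quantify over a total map
`MvPolynomial (Fin (n + 2)) k → S_M(k)`). [cite: VoisinHodgeII2003, §6.2.1] -/
def classifyingPoint (t₀ : AlgPoints (baseM k n d M) k) (G : MvPolynomial (Fin (n + 2)) k) :
    AlgPoints (baseM k n d M) k := by
  classical
  exact if h : G.IsHomogeneous d ∧ SmoothHypersurface.IsNonsingularForm k G ∧ IsSupportedOn n d M G
    then pointOfFormM k n d M h.1 h.2.1 h.2.2 else t₀

/-- On good forms the classifying map is `pointOfFormM`. [cite: VoisinHodgeII2003, §6.2.1] -/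
theorem classifyingPoint_eq (t₀ : AlgPoints (baseM k n d M) k) {G : MvPolynomial (Fin (n + 2)) k}
    (hG : G.IsHomogeneous d) (hJ : SmoothHypersurface.IsNonsingularForm k G)
    (hM : IsSupportedOn n d M G) :
    classifyingPoint k n d M t₀ G = pointOfFormM k n d M hG hJ hM := by
  classical
  unfold classifyingPoint
  rw [dif_pos ⟨hG, hJ, hM⟩]

/-- The classifying map is surjective onto `S_M(k)` already on good forms (`pointOfFormM_pointFormM`).
[cite: VoisinHodgeII2003, §6.2.1] -/
theorem classifyingPoint_pointFormM (t₀ t : AlgPoints (baseM k n d M) k) :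
    classifyingPoint k n d M t₀ (pointFormM k n d M t) = t := by
  rw [classifyingPoint_eq k n d M t₀ (isHomogeneous_pointForm k n d _)
    (isNonsingularForm_pointForm k n d _) (isSupportedOn_pointFormM k n d M t)]
  exact pointOfFormM_pointFormM k n d M t

/-- The fibre of the `M`-supported family over any `k`-point is a smooth projective geometrically
irreducible `n`-fold (`n ≥ 1`, `d ≥ 1`). [cite: VoisinHodgeII2003, §6.2.1] -/
theorem isSmoothProjective_fiberOver_familyM (hn : 1 ≤ n) (hd : 1 ≤ d)
    (t : AlgPoints (baseM k n d M) k) : IsSmoothProjective n (fiberOver (familyM k n d M) t) :=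
  (isSmoothProjectiveFamily_familyM k n d M hn hd).isSmoothProjective t

end Points

/-! ### The base `S_M`: an open subscheme of affine space -/

section Base

variable (k : Type u) [Field k] (n d : ℕ) (M : Set (DegIndex n d))

/-- `S_M ⟶ 𝔸^M` is an open immersion (`rfl`-level: it is `Scheme.Opens.ι`). [cite: Hartshorne1977, II Ex.
2.2 (open subschemes)] -/
theorem isOpenImmersion_baseMOpens_ι : IsOpenImmersion (baseMOpens k n d M).ι := inferInstance

/-- `R_M = k[a_m | m ∈ M]` is standard smooth over `k` of relative dimension `#M` (a polynomial ring in
finitely many variables; Hartshorne III §10 Example 10.0.1). [cite: Hartshorne1977, III §10 Example 10.0.1] -/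
theorem isStandardSmoothOfRelativeDimension_coeffRingM :
    Algebra.IsStandardSmoothOfRelativeDimension (Nat.card M) k (CoeffRingM k n d M) := by
  haveI : Fintype M := Fintype.ofFinite M
  rw [Nat.card_eq_fintype_card]
  haveI := ProjectiveSpace.isStandardSmoothOfRelativeDimension_mvPolynomial_fin k (Fintype.card M)
  exact Algebra.IsStandardSmoothOfRelativeDimension.of_algEquiv (Fintype.card M)
    (MvPolynomial.renameEquiv k (Fintype.equivFin M).symm)

/-- `𝔸^M = Spec R_M → Spec k` is smooth of relative dimension `#M`. [cite: Hartshorne1977, III §10 Example 10.0.1] -/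
theorem smoothOfRelativeDimension_specMToSpec :
    SmoothOfRelativeDimension (Nat.card M) (specMToSpec k n d M) := by
  rw [HasRingHomProperty.Spec_iff (P := @SmoothOfRelativeDimension (Nat.card M)),
    CommRingCat.hom_ofHom]
  refine RingHom.locally_of RingHom.isStandardSmoothOfRelativeDimension_respectsIso _ ?_
  rw [RingHom.isStandardSmoothOfRelativeDimension_algebraMap]
  exact isStandardSmoothOfRelativeDimension_coeffRingM k n d M

/-- **`S_M → Spec k` is smooth of relative dimension `#M`** (open subscheme of the affine space `𝔸^M`).
[cite: Hartshorne1977, III §10 Example 10.0.1] -/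
theorem smoothOfRelativeDimension_baseM_hom :
    SmoothOfRelativeDimension (0 + Nat.card M) (baseM k n d M).hom := by
  haveI := smoothOfRelativeDimension_specMToSpec k n d M
  change SmoothOfRelativeDimension _ ((baseMOpens k n d M).ι ≫ specMToSpec k n d M)
  infer_instance

/-- **`S_M` is smooth over `k`.** [cite: Hartshorne1977, III §10 Example 10.0.1] -/
theorem smooth_baseM_hom : Smooth (baseM k n d M).hom :=
  haveI := smoothOfRelativeDimension_baseM_hom k n d M
  SmoothOfRelativeDimension.smooth (0 + Nat.card M) _

/-- `S_M → Spec k` is locally of finite type (it is smooth). [cite: Hartshorne1977, III §10 Example 10.0.1] -/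
theorem locallyOfFiniteType_baseM_hom : LocallyOfFiniteType (baseM k n d M).hom :=
  haveI := smooth_baseM_hom k n d M
  inferInstance

/-- `S_M` is separated over `k` (open in an affine scheme). [cite: Hartshorne1977, II Cor. 4.6] -/
theorem isSeparated_baseM_hom : IsSeparated (baseM k n d M).hom := by
  change IsSeparated ((baseMOpens k n d M).ι ≫ specMToSpec k n d M)
  infer_instance

/-- `𝔸^M = Spec R_M` is irreducible (`R_M` is a domain). [cite: AtiyahMacdonald1969, Ch. 1 Ex. 19] -/
theorem irreducibleSpace_specCoeffRingM :
    IrreducibleSpace (Spec (CommRingCat.of (CoeffRingM k n d M))) :=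
  inferInstanceAs (IrreducibleSpace (PrimeSpectrum (CoeffRingM k n d M)))

/-- **`S_M` is irreducible as soon as it is non-empty** (a non-empty open subset of the irreducible
affine space `𝔸^M`); for non-emptiness see `nonempty_algPoints_baseM_iff` and
`irreducibleSpace_baseM_left_of_form`. [cite: Hartshorne1977, I Example 1.1.3] -/
theorem irreducibleSpace_baseM_left (h : Nonempty (baseM k n d M).left) :
    IrreducibleSpace (baseM k n d M).left := by
  obtain ⟨x⟩ := h
  haveI := irreducibleSpace_specCoeffRingM k n d M
  change IrreducibleSpace (baseMOpens k n d M)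
  exact isIrreducible_iff_irreducibleSpace.mp ⟨⟨(baseMOpens k n d M).ι x, by
    rw [← Scheme.Opens.range_ι]; exact ⟨x, rfl⟩⟩,
    (PreirreducibleSpace.isPreirreducible_univ (X := Spec (CommRingCat.of (CoeffRingM k n d M)))).open_subset
      (baseMOpens k n d M).isOpen (Set.subset_univ _)⟩

/-- A nonsingular `M`-supported form gives a point of the scheme `S_M`, whence `S_M` is irreducible.
[cite: Hartshorne1977, I Example 1.1.3] -/
theorem irreducibleSpace_baseM_left_of_form {G : MvPolynomial (Fin (n + 2)) k} (hG : G.IsHomogeneous d)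
    (hJ : SmoothHypersurface.IsNonsingularForm k G) (hM : IsSupportedOn n d M G) :
    IrreducibleSpace (baseM k n d M).left :=
  irreducibleSpace_baseM_left k n d M ⟨(pointOfFormM k n d M hG hJ hM).pt⟩

end Base

end Literature.AlgebraicGeometry.Motives.UniversalHypersurface

end
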